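import Summits.AtomisticToContinuum.FouriersLaw.Theses.ContactStieltjesMeasure
import Mathlib.Analysis.SpecialFunctions.ImproperIntegrals
import Mathlib.Analysis.SpecialFunctions.Integrals.Basic
import Mathlib.MeasureTheory.Function.SpecialFunctions.Basic

/-!
# Fractional-moment form of the γ-uniformity increment for `ContactUpperDensity`
(stmt-AtomisticToContinuum-15249) — checked scratch (planner, crux-ideate k1 g10). Nothing here is
proposed to the tree; it is evidence for the tenure planner / triage.

WHAT IS SHOWN (sorry-free).  Write `I_N(γ) := ∫₀^∞ Φ_N(t)·2t/(γ²+t²)² dt` (so the response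
coefficient is `(N-1)·γ·I_N(γ)`, i.e. `I_N(γ) = G_N(γ)/γ = ∫ dμ̂_N(s)/(γ²+s²)`).

* `condI_anti`     : `γ ↦ I_N(γ)` is antitone on `(0,∞)` — directly from `Φ_N ≥ 0` (no Stieltjes
                      theory needed).
* `tail_of_weighted_integral` : log-scale Chebyshev — for `h` antitone on `[1,Γ]`,
                      `h(Γ)·(Γ^ε−1)/ε ≤ ∫₁^Γ h(γ) γ^{ε−1} dγ`.
* `FractionalMomentBound` (FM_ε): same binders as the crux; conclusion
      `∃ ε ∈ (0,1], ∃ A N₀, ∀ N ≥ N₀, ∀ Γ ≥ 1, ∫₁^Γ (N·I_N(γ))·γ^{ε−1} dγ ≤ A`,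
  i.e. ONE linear functional of the contact measure, `N·∫ K_ε(s) dμ̂_N(s) ≤ A` with
  `K_ε(s) = ∫₁^∞ γ^{ε−1}/(γ²+s²)dγ ≍ min(1, s^{ε−2})`: "BoundedResponse at γ = 1 (kernel 1/(1+s²),
  item 11071) with an `s^ε` hair".
* `weak_of_fractionalMoment` : FM_ε ⟹ (U_w) := `ContactUpperDensityWeak` with exponent `a = 2 − ε`
  (the statement is VERBATIM the one of `Cruxes/ContactUpperDensity/Recut.lean`, whose sorry-free
  `Recut.closes_weak` shows that (U_w) already feeds the route's `closes`).

WHY IT MATTERS.  (U) as typed (`N·Φ_N(t) ≤ C(1+t)`, a = 1) is NOT a single-linear-functional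
statement: a kernel `K` with `N∫K dμ̂_N ≤ C ⟹ N·μ̂_N((t,2t]) ≤ C't ∀t` must satisfy `K(s) ≳ 1/s`, and
`N∫dμ̂_N/s = (2/π)∫₀^∞ N·G_N(γ)dγ/γ² … ≍ (4κ/π) log N` diverges in the Fourier scenario itself
(census k2g7 G5 / k2g9 #77: the matched-load functional).  So (U) is a genuine sup / maximal-density
statement (census B2's wall — "the √N bump survives every finite family of linear functionals" —
applies to it), while the re-cut target (U_w) is implied by ONE functional FM_ε for ANY ε > 0.  After
the re-cut recommended in `RECUT-NOTE-k1g6.md`, the whole γ-uniformity increment over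
`BoundedResponse`@γ=1 is therefore "ε of extra decay of the contact spectral measure", and every filed
card's transport input C⁺ may be weakened to whatever gives FM_ε.
-/

namespace Summit.AtomisticToContinuum.FouriersLaw.Cruxes.ContactUpperDensity.FractionalMoment

open MeasureTheory Filter Set intervalIntegral
open scoped Topology
open Summit.AtomisticToContinuum.FouriersLaw.Theses.ContactStieltjesMeasure

/-! ## Real analysis of the contact weight (copied from `Lines/frictiongrid.lean`, which is not an
importable module on the farm; proofs verbatim) -/

theorem hasDerivAt_negInvQuad (γ t : ℝ) (h : γ ^ 2 + t ^ 2 ≠ 0) :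
    HasDerivAt (fun s : ℝ => -(γ ^ 2 + s ^ 2)⁻¹) (2 * t / (γ ^ 2 + t ^ 2) ^ 2) t := by
  have h1 : HasDerivAt (fun s : ℝ => γ ^ 2 + s ^ 2) (2 * t) t :=
    ((hasDerivAt_pow 2 t).const_add (γ ^ 2)).congr_deriv (by norm_num)
  have h2 : HasDerivAt (-(fun s : ℝ => γ ^ 2 + s ^ 2)⁻¹) (2 * t / (γ ^ 2 + t ^ 2) ^ 2) t :=
    ((h1.inv h).neg).congr_deriv (by ring)
  exact h2

theorem tendsto_negInvQuad (γ : ℝ) : Tendsto (fun s : ℝ => -(γ ^ 2 + s ^ 2)⁻¹) atTop (𝓝 0) := by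
  have h1 : Tendsto (fun s : ℝ => γ ^ 2 + s ^ 2) atTop atTop :=
    tendsto_atTop_add_const_left _ _ (tendsto_pow_atTop two_ne_zero)
  have h2 := (tendsto_inv_atTop_zero.comp h1).neg
  simpa [Function.comp_def] using h2

theorem weight_nonneg {γ t : ℝ} (ht : 0 ≤ t) : 0 ≤ 2 * t / (γ ^ 2 + t ^ 2) ^ 2 := by
  positivity

theorem integral_weight_Ioi {γ a : ℝ} (hγ : 0 < γ) (ha : 0 ≤ a) :
    ∫ t in Ioi a, 2 * t / (γ ^ 2 + t ^ 2) ^ 2 = (γ ^ 2 + a ^ 2)⁻¹ := by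
  have hne : ∀ t : ℝ, γ ^ 2 + t ^ 2 ≠ 0 := fun t => by positivity
  have h := integral_Ioi_of_hasDerivAt_of_nonneg' (fun t _ => hasDerivAt_negInvQuad γ t (hne t))
    (fun t ht => weight_nonneg (ha.trans (Set.mem_Ioi.1 ht).le)) (tendsto_negInvQuad γ)
  rw [h]
  ring

theorem integrableOn_weight_Ioi {γ a : ℝ} (hγ : 0 < γ) (ha : 0 ≤ a) :
    IntegrableOn (fun t : ℝ => 2 * t / (γ ^ 2 + t ^ 2) ^ 2) (Ioi a) := by
  have hne : ∀ t : ℝ, γ ^ 2 + t ^ 2 ≠ 0 := fun t => by positivity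
  exact integrableOn_Ioi_deriv_of_nonneg' (fun t _ => hasDerivAt_negInvQuad γ t (hne t))
    (fun t ht => weight_nonneg (ha.trans (Set.mem_Ioi.1 ht).le)) (tendsto_negInvQuad γ)

/-- Nonnegativity of a contact distribution function. -/
theorem cdf_nonneg {φ : ℝ → ℝ} (hmono : Monotone φ) (hzero : ∀ s : ℝ, s ≤ 0 → φ s = 0)
    (t : ℝ) (ht : 0 ≤ t) : 0 ≤ φ t := by
  have h := hmono ht
  rwa [hzero 0 le_rfl] at h

/-- Integrability of `Φ · w_γ` on `(0,∞)` for a bounded contact distribution function. -/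
theorem integrableOn_cdf_mul_weight {φ : ℝ → ℝ} (hmono : Monotone φ)
    (hzero : ∀ s : ℝ, s ≤ 0 → φ s = 0) {m : ℝ} (hbdd : ∀ s : ℝ, φ s ≤ m) {γ : ℝ} (hγ : 0 < γ) :
    IntegrableOn (fun t : ℝ => φ t * (2 * t / (γ ^ 2 + t ^ 2) ^ 2)) (Ioi 0) := by
  have hwc : Continuous fun t : ℝ => 2 * t / (γ ^ 2 + t ^ 2) ^ 2 := by
    refine Continuous.div (by fun_prop) (by fun_prop) fun t => ?_
    positivity
  have hmeas : AEStronglyMeasurable (fun t : ℝ => φ t * (2 * t / (γ ^ 2 + t ^ 2) ^ 2))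
      (volume.restrict (Ioi (0 : ℝ))) :=
    (hmono.measurable.mul hwc.measurable).aestronglyMeasurable
  refine MeasureTheory.Integrable.mono'
    (MeasureTheory.Integrable.const_mul (integrableOn_weight_Ioi hγ le_rfl) m) hmeas ?_
  refine (ae_restrict_iff' measurableSet_Ioi).2 (Eventually.of_forall fun t ht => ?_)
  have ht' : 0 < t := Set.mem_Ioi.1 ht
  rw [Real.norm_eq_abs, abs_of_nonneg (mul_nonneg (cdf_nonneg hmono hzero t ht'.le)
    (weight_nonneg ht'.le))]
  exact mul_le_mul_of_nonneg_right (hbdd t) (weight_nonneg ht'.le)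

/-- SANDWICH (from `Lines/frictiongrid.lean`, proof verbatim): `φ(γ) ≤ 2γ·(γ·∫₀^∞ φ w_γ)`. -/
theorem sandwich {φ : ℝ → ℝ} (hmono : Monotone φ) (hzero : ∀ s : ℝ, s ≤ 0 → φ s = 0)
    {m : ℝ} (hbdd : ∀ s : ℝ, φ s ≤ m) {γ : ℝ} (hγ : 0 < γ) :
    φ γ ≤ 2 * γ * (γ * ∫ t in Ioi (0 : ℝ), φ t * (2 * t / (γ ^ 2 + t ^ 2) ^ 2)) := by
  have hφ0 : ∀ t : ℝ, 0 ≤ t → 0 ≤ φ t := cdf_nonneg hmono hzero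
  have hw0 : ∀ t : ℝ, 0 ≤ t → 0 ≤ 2 * t / (γ ^ 2 + t ^ 2) ^ 2 := fun t ht => weight_nonneg ht
  have hint : IntegrableOn (fun t : ℝ => φ t * (2 * t / (γ ^ 2 + t ^ 2) ^ 2)) (Ioi 0) :=
    integrableOn_cdf_mul_weight hmono hzero hbdd hγ
  have hnn : 0 ≤ᵐ[volume.restrict (Ioi (0 : ℝ))]
      (fun t : ℝ => φ t * (2 * t / (γ ^ 2 + t ^ 2) ^ 2)) := by
    refine (ae_restrict_iff' measurableSet_Ioi).2 (Eventually.of_forall fun t ht => ?_)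
    have ht' : 0 < t := Set.mem_Ioi.1 ht
    show (0 : ℝ) ≤ φ t * (2 * t / (γ ^ 2 + t ^ 2) ^ 2)
    exact mul_nonneg (hφ0 t ht'.le) (hw0 t ht'.le)
  have I3 : ∫ t in Ioi γ, φ t * (2 * t / (γ ^ 2 + t ^ 2) ^ 2) ≤
      ∫ t in Ioi (0 : ℝ), φ t * (2 * t / (γ ^ 2 + t ^ 2) ^ 2) :=
    setIntegral_mono_set hint hnn (ae_of_all _ fun x hx => Ioi_subset_Ioi hγ.le hx)
  have hintγ : IntegrableOn (fun t : ℝ => φ t * (2 * t / (γ ^ 2 + t ^ 2) ^ 2)) (Ioi γ) :=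
    hint.mono_set (Ioi_subset_Ioi hγ.le)
  have hwintγ : IntegrableOn (fun t : ℝ => 2 * t / (γ ^ 2 + t ^ 2) ^ 2) (Ioi γ) :=
    integrableOn_weight_Ioi hγ hγ.le
  have I2 : ∫ t in Ioi γ, φ γ * (2 * t / (γ ^ 2 + t ^ 2) ^ 2) ≤
      ∫ t in Ioi γ, φ t * (2 * t / (γ ^ 2 + t ^ 2) ^ 2) :=
    setIntegral_mono_on (MeasureTheory.Integrable.const_mul hwintγ (φ γ)) hintγ measurableSet_Ioi
      fun t ht => mul_le_mul_of_nonneg_right (hmono (Set.mem_Ioi.1 ht).le)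
        (hw0 t (hγ.le.trans (Set.mem_Ioi.1 ht).le))
  have I1 : ∫ t in Ioi γ, φ γ * (2 * t / (γ ^ 2 + t ^ 2) ^ 2) = φ γ * (γ ^ 2 + γ ^ 2)⁻¹ := by
    rw [MeasureTheory.integral_const_mul, integral_weight_Ioi hγ hγ.le]
  have key : φ γ * (γ ^ 2 + γ ^ 2)⁻¹ ≤ ∫ t in Ioi (0 : ℝ), φ t * (2 * t / (γ ^ 2 + t ^ 2) ^ 2) :=
    I1 ▸ I2.trans I3
  have hne : γ ^ 2 + γ ^ 2 ≠ 0 := by positivity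
  calc φ γ = 2 * γ * (γ * (φ γ * (γ ^ 2 + γ ^ 2)⁻¹)) := by field_simp; ring
    _ ≤ 2 * γ * (γ * ∫ t in Ioi (0 : ℝ), φ t * (2 * t / (γ ^ 2 + t ^ 2) ^ 2)) := by gcongr

/-! ## New: antitonicity of `I(γ) = ∫₀^∞ Φ w_γ` and the log-scale Chebyshev tail bound -/

/-- `γ ↦ ∫₀^∞ φ(t)·2t/(γ²+t²)² dt` is antitone on `(0,∞)` (pointwise in the weight; `φ ≥ 0`). -/
theorem condI_anti {φ : ℝ → ℝ} (hmono : Monotone φ) (hzero : ∀ s : ℝ, s ≤ 0 → φ s = 0)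
    {m : ℝ} (hbdd : ∀ s : ℝ, φ s ≤ m) {γ₁ γ₂ : ℝ} (hγ₁ : 0 < γ₁) (h12 : γ₁ ≤ γ₂) :
    ∫ t in Ioi (0 : ℝ), φ t * (2 * t / (γ₂ ^ 2 + t ^ 2) ^ 2) ≤
      ∫ t in Ioi (0 : ℝ), φ t * (2 * t / (γ₁ ^ 2 + t ^ 2) ^ 2) := by
  have hγ₂ : 0 < γ₂ := hγ₁.trans_le h12
  refine setIntegral_mono_on (integrableOn_cdf_mul_weight hmono hzero hbdd hγ₂)
    (integrableOn_cdf_mul_weight hmono hzero hbdd hγ₁) measurableSet_Ioi fun t ht => ?_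
  have ht' : 0 < t := Set.mem_Ioi.1 ht
  refine mul_le_mul_of_nonneg_left ?_ (cdf_nonneg hmono hzero t ht'.le)
  have hsq : (γ₁ ^ 2 + t ^ 2) ^ 2 ≤ (γ₂ ^ 2 + t ^ 2) ^ 2 := by
    have : γ₁ ^ 2 ≤ γ₂ ^ 2 := pow_le_pow_left₀ hγ₁.le h12 2
    gcongr
  exact div_le_div_of_nonneg_left (by positivity) (by positivity) hsq

/-- Log-scale Chebyshev: for `h` antitone on `[1,Γ]` and `ε > 0`,
`h(Γ)·(Γ^ε − 1)/ε ≤ ∫₁^Γ h(γ)·γ^{ε−1} dγ`. -/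
theorem tail_of_weighted_integral {h : ℝ → ℝ} {ε Γ : ℝ} (hε : 0 < ε) (hΓ : 1 ≤ Γ)
    (hanti : AntitoneOn h (Icc 1 Γ)) :
    h Γ * ((Γ ^ ε - 1) / ε) ≤ ∫ γ in (1 : ℝ)..Γ, h γ * γ ^ (ε - 1) := by
  have huIcc : uIcc (1 : ℝ) Γ = Icc 1 Γ := uIcc_of_le hΓ
  have hpow : ∫ γ in (1 : ℝ)..Γ, γ ^ (ε - 1) = (Γ ^ ε - 1) / ε := by
    rw [integral_rpow (Or.inl (by linarith))]
    simp only [sub_add_cancel, Real.one_rpow]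
  have hcont : ContinuousOn (fun γ : ℝ => γ ^ (ε - 1)) (uIcc 1 Γ) := by
    rw [huIcc]
    refine continuousOn_id.rpow_const fun x hx => Or.inl ?_
    have hx1 : (1 : ℝ) ≤ x := hx.1
    simp only [id]
    exact ne_of_gt (by linarith)
  have hf : IntervalIntegrable (fun γ : ℝ => h Γ * γ ^ (ε - 1)) volume 1 Γ :=
    (hcont.intervalIntegrable).const_mul (h Γ)
  have hanti' : AntitoneOn h (uIcc 1 Γ) := by rwa [huIcc]
  have hg : IntervalIntegrable (fun γ : ℝ => h γ * γ ^ (ε - 1)) volume 1 Γ :=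
    hanti'.intervalIntegrable.mul_continuousOn hcont
  calc h Γ * ((Γ ^ ε - 1) / ε) = ∫ γ in (1 : ℝ)..Γ, h Γ * γ ^ (ε - 1) := by
        rw [intervalIntegral.integral_const_mul, hpow]
    _ ≤ ∫ γ in (1 : ℝ)..Γ, h γ * γ ^ (ε - 1) := by
        refine intervalIntegral.integral_mono_on hΓ hf hg fun γ hγ => ?_
        exact mul_le_mul_of_nonneg_right (hanti hγ ⟨hΓ, le_rfl⟩ hγ.2)
          (Real.rpow_nonneg (by linarith [hγ.1]) _)

/-! ## The statements -/

/-- (U_w) — VERBATIM the statement `Recut.ContactUpperDensityWeak` of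
`Cruxes/ContactUpperDensity/Recut.lean` (same binders as the crux; conclusion with SOME exponent
`a < 2`); `Recut.closes_weak` (sorry-free there) feeds it into the route's `closes`. -/
def ContactUpperDensityWeak : Prop :=
    ∀ ω₂ lam β : ℝ, 0 < ω₂ → 0 < lam → 0 < β → ∀ T : ℝ, 0 < T → ∀ Φ : ℕ → ℝ → ℝ, (∀ N : ℕ, 2 ≤ N → Monotone (Φ N) ∧ (∀ s : ℝ, s ≤ 0 → Φ N s = 0) ∧ (∃ m : ℝ, ∀ s : ℝ, Φ N s ≤ m) ∧ ∀ γ : ℝ, 0 < γ → (∀ (N' : ℕ) (T_L T_R : ℝ), 0 < T_L → 0 < T_R → ∀ μ ν : MeasureTheory.Measure (Literature.MathematicalPhysics.KineticTheory.HeatConduction.PhaseSpace N'), (Literature.MathematicalPhysics.KineticTheory.HeatConduction.pinnedChain ω₂ lam β γ).IsSteadyState N' T_L T_R μ → (Literature.MathematicalPhysics.KineticTheory.HeatConduction.pinnedChain ω₂ lam β γ).IsSteadyState N' T_L T_R ν → μ = ν) → ∀ μ : (N' : ℕ) → ℝ → ℝ → MeasureTheory.Measure (Literature.MathematicalPhysics.KineticTheory.HeatConduction.PhaseSpace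 N'), (∀ (N' : ℕ) (T_L T_R : ℝ), 0 < T_L → 0 < T_R → (Literature.MathematicalPhysics.KineticTheory.HeatConduction.pinnedChain ω₂ lam β γ).IsSteadyState N' T_L T_R (μ N' T_L T_R)) → Filter.Tendsto (fun δ : ℝ => (Literature.MathematicalPhysics.KineticTheory.HeatConduction.pinnedChain ω₂ lam β γ).totalCurrent (μ N (T + δ / 2) (T - δ / 2)) / δ) (nhdsWithin 0 {(0 : ℝ)}ᶜ) (nhds (((N : ℝ) - 1) * γ * ∫ t in Set.Ioi (0 : ℝ), Φ N t * (2 * t / (γ ^ 2 + t ^ 2) ^ 2)))) → ∃ a : ℝ, a < 2 ∧ ∃ C : ℝ, ∃ N₀ : ℕ, ∀ N : ℕ, N₀ ≤ N → ∀ t : ℝ, 0 < t → (N : ℝ) * Φ N t ≤ C * (1 + t) ^ a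

/-- (FM_ε) FRACTIONAL-MOMENT BOUND — same binders as the crux; conclusion: for SOME `ε ∈ (0,1]` the
log-scale-weighted integral of `N·I_N(γ) = N·G_N(γ)/γ` over `γ ∈ [1,Γ]` is bounded uniformly in
`Γ ≥ 1` and `N ≥ N₀` (one linear functional of the contact measure, kernel `≍ min(1, s^{ε-2})`). -/
def FractionalMomentBound : Prop :=
    ∀ ω₂ lam β : ℝ, 0 < ω₂ → 0 < lam → 0 < β → ∀ T : ℝ, 0 < T → ∀ Φ : ℕ → ℝ → ℝ, (∀ N : ℕ, 2 ≤ N → Monotone (Φ N) ∧ (∀ s : ℝ, s ≤ 0 → Φ N s = 0) ∧ (∃ m : ℝ, ∀ s : ℝ, Φ N s ≤ m) ∧ ∀ γ : ℝ, 0 < γ → (∀ (N' : ℕ) (T_L T_R : ℝ), 0 < T_L → 0 < T_R → ∀ μ ν : MeasureTheory.Measure (Literature.MathematicalPhysics.KineticTheory.HeatConduction.PhaseSpace N'), (Literature.MathematicalPhysics.KineticTheory.HeatConduction.pinnedChain ω₂ lam β γ).IsSteadyState N' T_L T_R μ → (Literature.MathematicalPhysics.KineticTheory.HeatConduction.pinnedChain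 ω₂ lam β γ).IsSteadyState N' T_L T_R ν → μ = ν) → ∀ μ : (N' : ℕ) → ℝ → ℝ → MeasureTheory.Measure (Literature.MathematicalPhysics.KineticTheory.HeatConduction.PhaseSpace N'), (∀ (N' : ℕ) (T_L T_R : ℝ), 0 < T_L → 0 < T_R → (Literature.MathematicalPhysics.KineticTheory.HeatConduction.pinnedChain ω₂ lam β γ).IsSteadyState N' T_L T_R (μ N' T_L T_R)) → Filter.Tendsto (fun δ : ℝ => (Literature.MathematicalPhysics.KineticTheory.HeatConduction.pinnedChain ω₂ lam β γ).totalCurrent (μ N (T + δ / 2) (T - δ / 2)) / δ) (nhdsWithin 0 {(0 : ℝ)}ᶜ) (nhds (((N : ℝ) - 1) * γ * ∫ t in Set.Ioi (0 : ℝ), Φ N t * (2 * t / (γ ^ 2 + t ^ 2) ^ 2)))) → ∃ ε : ℝ, 0 < ε ∧ ε ≤ 1 ∧ ∃ A : ℝ, ∃ N₀ : ℕ, ∀ N : ℕ, N₀ ≤ N → ∀ Γ : ℝ, 1 ≤ Γ → ∫ γ in (1 : ℝ)..Γ, ((N : ℝ) * ∫ t in Set.Ioi (0 : ℝ), Φ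 N t * (2 * t / (γ ^ 2 + t ^ 2) ^ 2)) * γ ^ (ε - 1) ≤ A

/-! ## FM_ε ⟹ (U_w) with `a = 2 − ε` -/

theorem weak_of_fractionalMoment (hFM : FractionalMomentBound) : ContactUpperDensityWeak := by
  intro ω₂ lam β hω hl hβ T hT Φ hΦ
  obtain ⟨ε, hε, hε1, A, N₀, hA⟩ := hFM ω₂ lam β hω hl hβ T hT Φ hΦ
  -- threshold scale t₀ with t₀^ε = 2
  set t₀ : ℝ := (2 : ℝ) ^ (1 / ε) with ht₀def
  have ht₀pos : 0 < t₀ := Real.rpow_pos_of_pos (by norm_num) _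
  have ht₀ε : t₀ ^ ε = 2 := by
    rw [ht₀def, ← Real.rpow_mul (by norm_num : (0 : ℝ) ≤ 2)]
    rw [one_div_mul_cancel hε.ne', Real.rpow_one]
  refine ⟨2 - ε, by linarith, 4 * A * ε * (1 + t₀) ^ (2 - ε), max N₀ 2, fun N hN t ht => ?_⟩
  have hN0 : N₀ ≤ N := le_trans (le_max_left _ _) hN
  have hN2 : 2 ≤ N := le_trans (le_max_right _ _) hN
  have hNr : (0 : ℝ) ≤ (N : ℝ) := Nat.cast_nonneg N
  obtain ⟨hmono, hzero, ⟨m, hm⟩, _⟩ := hΦ N hN2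
  -- 0 ≤ A (the functional at Γ = 1 is 0)
  have hA0 : 0 ≤ A := by
    have h := hA N hN0 1 le_rfl
    rwa [intervalIntegral.integral_same] at h
  -- the antitone function h(γ) = N · I_N(γ)
  set h : ℝ → ℝ := fun γ => (N : ℝ) * ∫ t in Set.Ioi (0 : ℝ), Φ N t * (2 * t / (γ ^ 2 + t ^ 2) ^ 2)
    with hhdef
  have hanti : ∀ Γ : ℝ, AntitoneOn h (Icc 1 Γ) := fun Γ γ₁ hγ₁ γ₂ _ h12 => by
    simp only [hhdef]
    exact mul_le_mul_of_nonneg_left (condI_anti hmono hzero hm (by linarith [hγ₁.1]) h12) hNr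
  -- CORE: at scales s with s^ε ≥ 2, N Φ_N(s) ≤ 4 A ε (1+s)^(2-ε)
  have core : ∀ s : ℝ, 0 < s → 2 ≤ s ^ ε → (N : ℝ) * Φ N s ≤ 4 * A * ε * (1 + s) ^ (2 - ε) := by
    intro s hs hs2
    have hs1 : 1 ≤ s := by
      by_contra hlt
      have : s ^ ε ≤ 1 := Real.rpow_le_one hs.le (le_of_lt (not_le.1 hlt)) hε.le
      linarith
    -- log-Chebyshev: h(s) (s^ε - 1)/ε ≤ A, hence h(s) ≤ 2 A ε / s^ε
    have hcheb : h s * ((s ^ ε - 1) / ε) ≤ A := (tail_of_weighted_integral hε hs1 (hanti s)).trans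
      (by simpa [hhdef] using hA N hN0 s hs1)
    have hsε : 0 < s ^ ε := Real.rpow_pos_of_pos hs ε
    have hden : 0 < (s ^ ε - 1) / ε := div_pos (by linarith) hε
    have hh : h s ≤ A / ((s ^ ε - 1) / ε) := (le_div_iff₀ hden).2 hcheb
    have hh' : h s ≤ 2 * A * ε / s ^ ε := by
      refine hh.trans ?_
      rw [div_le_div_iff₀ hden hsε]
      -- A * s^ε ≤ 2Aε (s^ε - 1)/ε = 2A (s^ε - 1)
      have : 2 * A * ε * ((s ^ ε - 1) / ε) = 2 * A * (s ^ ε - 1) := by field_simp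
      rw [this]
      nlinarith [hA0, hs2]
    -- sandwich: N Φ(s) ≤ 2 s² h(s)
    have hsand : Φ N s ≤ 2 * s * (s * ∫ t in Ioi (0 : ℝ), Φ N t * (2 * t / (s ^ 2 + t ^ 2) ^ 2)) :=
      sandwich hmono hzero hm hs
    have hNΦ : (N : ℝ) * Φ N s ≤ 2 * s ^ 2 * h s := by
      have := mul_le_mul_of_nonneg_left hsand hNr
      simp only [hhdef]
      nlinarith [this]
    -- 2 s² · (2Aε/s^ε) = 4 A ε s^(2-ε) ≤ 4 A ε (1+s)^(2-ε)
    have hs2ε : s ^ (2 - ε) = s ^ 2 / s ^ ε := by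
      rw [Real.rpow_sub hs, Real.rpow_two]
    have h1s : s ^ (2 - ε) ≤ (1 + s) ^ (2 - ε) :=
      Real.rpow_le_rpow hs.le (by linarith) (by linarith)
    have hs2nn : 0 ≤ 2 * s ^ 2 := by positivity
    calc (N : ℝ) * Φ N s ≤ 2 * s ^ 2 * h s := hNΦ
      _ ≤ 2 * s ^ 2 * (2 * A * ε / s ^ ε) := mul_le_mul_of_nonneg_left hh' hs2nn
      _ = 4 * A * ε * s ^ (2 - ε) := by rw [hs2ε]; ring
      _ ≤ 4 * A * ε * (1 + s) ^ (2 - ε) := by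
          exact mul_le_mul_of_nonneg_left h1s (by positivity)
  have hC0 : 0 ≤ 4 * A * ε * (1 + t₀) ^ (2 - ε) := by positivity
  have h1t : 1 ≤ (1 + t) ^ (2 - ε) := Real.one_le_rpow (by linarith) (by linarith)
  by_cases ht2 : 2 ≤ t ^ ε
  · -- large scales: core at t, then enlarge the constant
    calc (N : ℝ) * Φ N t ≤ 4 * A * ε * (1 + t) ^ (2 - ε) := core t ht ht2
      _ = 4 * A * ε * 1 * (1 + t) ^ (2 - ε) := by ring
      _ ≤ 4 * A * ε * (1 + t₀) ^ (2 - ε) * (1 + t) ^ (2 - ε) := by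
          have h1t₀ : (1 : ℝ) ≤ (1 + t₀) ^ (2 - ε) := Real.one_le_rpow (by linarith) (by linarith)
          have : 0 ≤ 4 * A * ε := by positivity
          gcongr
  · -- small scales: t < t₀, monotonicity of Φ_N and core at t₀
    have htlt : t < t₀ := by
      have h' : t ^ ε < t₀ ^ ε := by rw [ht₀ε]; exact not_le.1 ht2
      exact (Real.rpow_lt_rpow_iff ht.le ht₀pos.le hε).1 h'
    have hmon : (N : ℝ) * Φ N t ≤ (N : ℝ) * Φ N t₀ :=
      mul_le_mul_of_nonneg_left (hmono htlt.le) hNr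
    calc (N : ℝ) * Φ N t ≤ (N : ℝ) * Φ N t₀ := hmon
      _ ≤ 4 * A * ε * (1 + t₀) ^ (2 - ε) := core t₀ ht₀pos (by rw [ht₀ε])
      _ = 4 * A * ε * (1 + t₀) ^ (2 - ε) * 1 := by ring
      _ ≤ 4 * A * ε * (1 + t₀) ^ (2 - ε) * (1 + t) ^ (2 - ε) :=
          mul_le_mul_of_nonneg_left h1t hC0


end Summit.AtomisticToContinuum.FouriersLaw.Cruxes.ContactUpperDensity.FractionalMoment
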